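import Summits.Ventures.YMGap.RobustBall.ErgodicAverages
import Summits.Ventures.YMGap.RobustBall.ThermodynamicVariance
import Summits.Ventures.YMGap.RobustBall.WilsonOneStateSymmetry
import HarnessLib

/-!
# Venture YMGap, track ROBUST-BALL — ERGODIC AVERAGES AND THE THERMODYNAMIC VARIANCE DENSITY FOR EVERY `SU(N)` AND EVERY `d ≥ 2`: under THE state
# on the sharp window every bounded measurable local observable has absolutely summable autocovariance, is self-averaging almost surely and in `L²`
# along cubes, and its variance density converges to its susceptibility

HONEST FRAMING. WHAT THIS IS: a venture file (cell `pub-ymgap`, track Y2 ROBUST-BALL / DS, seat ds-3, theorems only, 0 compute): the every-`N`, every-`d`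
cells of `ErgodicAverages.su2_wilson_ae_tendsto_boxAverage` and `ThermodynamicVariance.su2_wilson_tendsto_variance_boxSum_div` (which are `SU(2)`, `d = 4`,
star window). Window: 't Hooft `|β| < 1/(8d)` (the sharp single-link window), tree coupling `Nβ`; `μ` THE DLR state (unique, translation invariant —
`suN_wilson_oneState_symmetric_sharp`); `F` ANY bounded measurable local observable (no gauge invariance needed: the clustering clause of `MassGapAt d N β`
is for Lipschitz cylinders, upgraded to bounded local observables by `MassGapMassive.covariance_decay_of_lipschitzClustering`):
* ★★ `suN_wilson_summable_autocovariance_dim` — `Σ_{v∈ℤ^d} |cov_μ(F, F∘θ_v)| < ∞` (`ThermodynamicVariance.summable_abs_of_exp_decay`);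
* ★★ `suN_wilson_ae_tendsto_boxAverage_dim` — `#B_n⁻¹ Σ_{x∈B_n} F(θ_x U) → μ(F)` for `μ`-almost every `U`, and the Chebyshev rate
  `μ{|#B⁻¹ Σ_{x∈B} F∘θ_x − μ(F)| ≥ ε} ≤ C_F/(ε² #B)` for every finite nonempty `B`;
* ★★ `suN_wilson_tendsto_variance_boxSum_div_dim` — `Var_μ(Σ_{x∈B_n} F∘θ_x)/#B_n → Σ_v cov_μ(F, F∘θ_v) ≥ 0` — the thermodynamic fluctuation density of
  every such observable is its susceptibility — every `N ≥ 2`, every `d ≥ 2`, HYPOTHESIS-FREE.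
WHAT THIS IS NOT: lattice strong coupling on the sharp window; second-moment statements (no CLT / LDP here); nothing about the continuum limit or Clay.
Everything here is proved. [folklore]
-/

noncomputable section

open MeasureTheory ProbabilityTheory Filter Topology Real Finset Set
open scoped NNReal ENNReal
open Literature.Probability.LatticeModels hiding configShift configShift_apply
open Literature.MathematicalPhysics.QuantumLattice

namespace Summit.Ventures.YMGap.RobustBall

namespace ErgodicAverages

variable {d N : ℕ}

/-- ★★ **ABSOLUTELY SUMMABLE AUTOCOVARIANCES UNDER THE STATE, EVERY `N ≥ 2`, EVERY `d ≥ 2`** (sharp window `|β| < 1/(8d)`, `μ` THE DLR state at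
`Nβ`): THE state is translation invariant and, for every bounded measurable local observable `F`, `Σ_{v∈ℤ^d} |cov_μ(F, F∘θ_v)| < ∞` with an exponential
decay rate `|cov_μ(F, F∘θ_v)| ≤ C e^{−c‖v‖_∞}`, `c > 0`. [folklore] -/
theorem suN_wilson_summable_autocovariance_dim [NeZero d] (hd : 2 ≤ d) (hN : 2 ≤ N) {β : ℝ}
    (hβs : |β| < HessianSharp.sharpThresholdSU d) {μ : Measure (LGConfig d (SUN N))}
    (hμ : μ ∈ ymGibbsMeasures (d := d) (fundamentalRep (Fin N)) (N * β))
    (F : LGConfig d (SUN N) → ℝ) (hloc : IsLocalObservable F) (hFm : Measurable F) (hFb : ∃ C, ∀ U, |F U| ≤ C) :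
    IsZdTranslationInvariant μ ∧
      (∃ c C : ℝ, 0 < c ∧ ∀ v : Site d, |cov[F, fun U => F (configShift v U); μ]| ≤ C * Real.exp (-c * ‖v‖)) ∧
      Summable fun v : Site d => |cov[F, fun U => F (configShift v U); μ]| := by
  haveI : SecondCountableTopology (Matrix.specialUnitaryGroup (Fin N) ℂ) :=
    haveI : SecondCountableTopology (Matrix (Fin N) (Fin N) ℂ) := inferInstanceAs (SecondCountableTopology (Fin N → Fin N → ℂ))
    Topology.IsEmbedding.subtypeVal.secondCountableTopology
  have hG : IsGibbsMeasure (ymSpecification (d := d) (fundamentalRep (Fin N)) (N * β)) μ := hμ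
  haveI := hG.isProbabilityMeasure
  obtain ⟨ν, h1, -, hinv, -⟩ := suN_wilson_oneState_symmetric_sharp hd hN hβs
  have hμν : μ = ν := by rw [h1] at hμ; exact Set.mem_singleton_iff.1 hμ
  rw [← hμν] at hinv
  obtain ⟨c, hc, hcl⟩ := (SharpUniquenessJoin.massGapAt_sharp_free hd hN hβs).2 μ hμ
  obtain ⟨C₀, hC₀⟩ := MassGapMassive.covariance_decay_of_lipschitzClustering (by omega) (by omega) (N * β) hμ hc hcl F F hloc hloc hFm hFm hFb hFb
  exact ⟨hinv, ⟨c, C₀, hc, hC₀⟩, ThermodynamicVariance.summable_abs_of_exp_decay (by omega) hc hC₀⟩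

/-- ★★ **CELL — ALMOST-SURE SELF-AVERAGING FOR `SU(N)` LATTICE YANG–MILLS ON `ℤ^d`, EVERY `N ≥ 2`, EVERY `d ≥ 2`** (sharp window `|β| < 1/(8d)`, tree
coupling `Nβ`): THE DLR state `μ` is unique and translation invariant, and for EVERY bounded measurable local observable `F`, for `μ`-almost every
configuration `U` the cube averages `#B_n⁻¹ Σ_{x∈B_n} F(θ_x U)` converge to `μ(F)`, with the Chebyshev rate
`μ{|#B⁻¹ Σ_{x∈B} F∘θ_x − μ(F)| ≥ ε} ≤ C_F/(ε² #B)` for every finite nonempty `B` — HYPOTHESIS-FREE. [folklore] -/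
theorem suN_wilson_ae_tendsto_boxAverage_dim [NeZero d] (hd : 2 ≤ d) (hN : 2 ≤ N) {β : ℝ} (hβs : |β| < HessianSharp.sharpThresholdSU d) :
    ∃ μ : Measure (LGConfig d (SUN N)),
      ymGibbsMeasures (d := d) (fundamentalRep (Fin N)) (N * β) = {μ} ∧ IsZdTranslationInvariant μ ∧
      ∀ F : LGConfig d (SUN N) → ℝ, IsLocalObservable F → Measurable F → (∃ C, ∀ U, |F U| ≤ C) →
        (∀ᵐ U ∂μ, Tendsto (fun n : ℕ => (∑ x ∈ siteBox d n, F (configShift x U)) / (siteBox d n).card) atTop (𝓝 (∫ U', F U' ∂μ))) ∧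
        ∃ C : ℝ, ∀ (B : Finset (Site d)), B.Nonempty → ∀ ε : ℝ, 0 < ε →
          μ {U | ε ≤ |(∑ x ∈ B, F (configShift x U)) / B.card - ∫ U', F U' ∂μ|} ≤ ENNReal.ofReal (C / (ε ^ 2 * B.card)) := by
  obtain ⟨μ, h1, -, hinv, -⟩ := suN_wilson_oneState_symmetric_sharp hd hN hβs
  have hμ : μ ∈ ymGibbsMeasures (d := d) (fundamentalRep (Fin N)) (N * β) := by rw [h1]; exact Set.mem_singleton _
  have hG : IsGibbsMeasure (ymSpecification (d := d) (fundamentalRep (Fin N)) (N * β)) μ := hμ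
  haveI := hG.isProbabilityMeasure
  refine ⟨μ, h1, hinv, fun F hloc hFm hFb => ?_⟩
  obtain ⟨-, -, hs⟩ := suN_wilson_summable_autocovariance_dim hd hN hβs hμ F hloc hFm hFb
  obtain ⟨M, hM⟩ := hFb
  exact ⟨ae_tendsto_boxAverage hd hinv hFm hM hs,
    ⟨∑' v, |cov[F, fun U => F (configShift v U); μ]|, fun B hB ε hε => measure_abs_boxAverage_sub_ge_le hinv hFm hM hs hB hε⟩⟩

/-- ★★ **CELL — THE THERMODYNAMIC VARIANCE DENSITY IS THE SUSCEPTIBILITY, EVERY `N ≥ 2`, EVERY `d ≥ 2`** (sharp window `|β| < 1/(8d)`, tree coupling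
`Nβ`, THE DLR state `μ`): for EVERY bounded measurable local observable `F`, the autocovariance is absolutely summable and
`Var_μ(Σ_{x∈B_n} F∘θ_x)/#B_n → χ(F) = Σ_v cov_μ(F, F∘θ_v)`, with `χ(F) ≥ 0` — HYPOTHESIS-FREE. [folklore] -/
theorem suN_wilson_tendsto_variance_boxSum_div_dim [NeZero d] (hd : 2 ≤ d) (hN : 2 ≤ N) {β : ℝ}
    (hβs : |β| < HessianSharp.sharpThresholdSU d) {μ : Measure (LGConfig d (SUN N))}
    (hμ : μ ∈ ymGibbsMeasures (d := d) (fundamentalRep (Fin N)) (N * β))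
    (F : LGConfig d (SUN N) → ℝ) (hloc : IsLocalObservable F) (hFm : Measurable F) (hFb : ∃ C, ∀ U, |F U| ≤ C) :
    Summable (fun v : Site d => |cov[F, fun U => F (configShift v U); μ]|) ∧
      Tendsto (fun n : ℕ => Var[fun U => ∑ x ∈ siteBox d n, F (configShift x U); μ] / (siteBox d n).card) atTop
        (𝓝 (∑' v, cov[F, fun U => F (configShift v U); μ])) ∧
      0 ≤ ∑' v, cov[F, fun U => F (configShift v U); μ] := by
  have hG : IsGibbsMeasure (ymSpecification (d := d) (fundamentalRep (Fin N)) (N * β)) μ := hμ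
  haveI := hG.isProbabilityMeasure
  obtain ⟨hinv, -, hs⟩ := suN_wilson_summable_autocovariance_dim hd hN hβs hμ F hloc hFm hFb
  obtain ⟨M, hM⟩ := hFb
  exact ⟨hs, ThermodynamicVariance.tendsto_variance_boxSum_div hinv hFm hM hs, ThermodynamicVariance.tsum_covariance_shift_nonneg hinv hFm hM hs⟩

end ErgodicAverages

end Summit.Ventures.YMGap.RobustBall

end
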